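import Summits.CriticalPhenomena.PercolationContinuityZ3.Theorems.PercNearOneGluingNoHeavyLowerTailTwoCopyEvalKernel

/-!
# Crux `NoHeavyLowerTail` (stmt-CriticalPhenomena-4575), certificate programme for the `|A| = 5` one-cut rung:
# the evaluation checker `evalCheck` and its soundness (with DEGREE ELEVATION)

A product-form certificate for targets `t_j` (integer configuration functions on `m` coordinates), a
hypothesis `h`, multipliers `a_j ≥ 0` and `b ≥ 0` proves `Σ_j E_w[t_j]·Â_j(w) ≥ E_w[h]·B̂(w)` on the cube,
where the multiplier of coordinate-degree profile `deg` (`deg i ∈ {1, 2}`) is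
`Â(w) = Σ_k a(k) Π_i w_i^{k_i} (1 − w_i)^{deg i − k_i}` (`exA`; `k` in mixed radix `deg i + 1`; `deg ≡ 1` is
the two-copy case of `…TwoCopyFibre`).  In the variables `y_i = w_i/(1−w_i)` everything is a product of
generating polynomials, whose coefficients (`fibD`, mixed radix `deg i + 2`) the checker computes by
evaluation at `deg i + 2` points per coordinate (`Mpt`: `0, 1, [−1,] ∞`), pointwise products, and scaled
interpolation (`Ninv`), all through the transform of `…TwoCopyEvalKernel` — `O(m Π(deg i + 2))` operations
instead of `Π 2(deg i + 1) · 2^m`.  `rd_evalArr` identifies the computed array with `SC · fibD` (`fibD_nonneg_of_evalCheck`);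
the real-analytic soundness statements are in `…TwoCopyEvalSound`.  (For `m = 15` this checker is too
slow in the evaluator; the Kronecker checker of `…TwoCopyKron` computes the same `fibD` natively.)
Bookkeeping only; nothing about the crux.
-/

namespace Summit.CriticalPhenomena.PercolationContinuityZ3.Theorems.TwoCopy

open Finset

/-! ## Profiles and matrices -/

/-- Multiplier radix `deg i + 1`. [this work] -/
def radA (deg : ℕ → ℕ) (i : ℕ) : ℕ := deg i + 1

/-- Fibre radix `deg i + 2`. [this work] -/
def radF (deg : ℕ → ℕ) (i : ℕ) : ℕ := deg i + 2

/-- Positivity of the multiplier radices. [this work] -/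
theorem radA_pos (deg : ℕ → ℕ) : ∀ i, 0 < radA deg i := fun _ => Nat.succ_pos _

/-- Positivity of the fibre radices. [this work] -/
theorem radF_pos (deg : ℕ → ℕ) : ∀ i, 0 < radF deg i := fun _ => Nat.succ_pos _

/-- The multiplier radices are at most `4` for degrees `≤ 2`. [this work] -/
theorem radA_le4 {deg : ℕ → ℕ} (hdeg : ∀ i, deg i = 1 ∨ deg i = 2) : ∀ i, radA deg i ≤ 4 :=
  fun i => by unfold radA; rcases hdeg i with h | h <;> omega

/-- The fibre radices are at most `4` for degrees `≤ 2`. [this work] -/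
theorem radF_le4 {deg : ℕ → ℕ} (hdeg : ∀ i, deg i = 1 ∨ deg i = 2) : ∀ i, radF deg i ≤ 4 :=
  fun i => by unfold radF; rcases hdeg i with h | h <;> omega

/-- The binary profile is at most `4`. [this work] -/
theorem two_le4 : ∀ i : ℕ, (fun _ : ℕ => 2) i ≤ 4 := fun _ => by norm_num

/-- Positivity of the binary profile. [this work] -/
theorem two_pos' : ∀ i : ℕ, 0 < (fun _ : ℕ => 2) i := fun _ => Nat.succ_pos _

/-- Evaluation matrix of a radix-`ρ` coordinate: the value of `y^b` (formal degree `D`) at the `e`-th point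
of `(0, 1, ∞)` for `ρ = 3` and of `(0, 1, −1, ∞)` for `ρ = 4`. [this work] -/
def Mpt (ρ D e b : ℕ) : ℤ :=
  if e = 0 then (if b = 0 then 1 else 0)
  else if e = 1 then 1
  else if e + 1 = ρ then (if b = D then 1 else 0)
  else (-1) ^ b

/-- Scaled interpolation matrix (scale `scal ρ`): recovers the coefficient of `y^d` of a product from its
point values. [this work] -/
def Ninv (ρ d e : ℕ) : ℤ :=
  if ρ = 3 then
    (if d = 0 then (if e = 0 then 1 else 0)
     else if d = 1 then (if e = 0 then -1 else if e = 1 then 1 else -1)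
     else (if e = 2 then 1 else 0))
  else
    (if d = 0 then (if e = 0 then 2 else 0)
     else if d = 1 then (if e = 0 then 0 else if e = 1 then 1 else if e = 2 then -1 else -2)
     else if d = 2 then (if e = 0 then -2 else if e = 1 then 1 else if e = 2 then 1 else 0)
     else (if e = 3 then 2 else 0))

/-- The interpolation scale: `1` for radix `3`, `2` for radix `4`. [this work] -/
def scal (ρ : ℕ) : ℤ := if ρ = 3 then 1 else 2

/-- The radix-3 key identity: interpolation ∘ (evaluation ⊗ evaluation) = coefficient extraction. [this work] -/
theorem key3 : ∀ d < 3, ∀ b < 2, ∀ c < 2,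
    ∑ e ∈ range 3, Ninv 3 d e * (Mpt 3 1 e b * Mpt 3 1 e c) = if d = b + c then (1 : ℤ) else 0 := by
  intro d hd b hb c hc
  interval_cases d <;> interval_cases b <;> interval_cases c <;> norm_num [sum_range_succ, Ninv, Mpt]

/-- The radix-4 key identity (scale 2). [this work] -/
theorem key4 : ∀ d < 4, ∀ b < 2, ∀ c < 3,
    ∑ e ∈ range 4, Ninv 4 d e * (Mpt 4 1 e b * Mpt 4 2 e c) = if d = b + c then (2 : ℤ) else 0 := by
  intro d hd b hb c hc
  interval_cases d <;> interval_cases b <;> interval_cases c <;> norm_num [sum_range_succ, Ninv, Mpt]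

/-- The key identity for a coordinate of degree `1` or `2`. [this work] -/
theorem key_deg {dg : ℕ} (hdg : dg = 1 ∨ dg = 2) {d b c : ℕ} (hd : d < dg + 2) (hb : b < 2) (hc : c < dg + 1) :
    ∑ e ∈ range (dg + 2), Ninv (dg + 2) d e * (Mpt (dg + 2) 1 e b * Mpt (dg + 2) dg e c) =
      if d = b + c then scal (dg + 2) else 0 := by
  rcases hdg with rfl | rfl
  · rw [key3 d hd b hb c hc]; simp [scal]
  · rw [key4 d hd b hb c hc]; simp [scal]

/-- Target evaluation matrix of coordinate `i`. [this work] -/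
def MT (deg : ℕ → ℕ) (i e c : ℕ) : ℤ := Mpt (radF deg i) 1 e c

/-- Multiplier evaluation matrix of coordinate `i`. [this work] -/
def MA (deg : ℕ → ℕ) (i e c : ℕ) : ℤ := Mpt (radF deg i) (deg i) e c

/-- Interpolation matrix of coordinate `i`. [this work] -/
def NI (deg : ℕ → ℕ) (i d e : ℕ) : ℤ := Ninv (radF deg i) d e

/-! ## The checker -/

/-- Forward transform of a target table (binary input). [this work] -/
def fwdT (m : ℕ) (deg : ℕ → ℕ) (f : ℕ → ℤ) : Array ℤ :=
  fwd (fun _ => 2) (radF deg) (MT deg) m m (mkArr (plc (fun _ => 2) m) f)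

/-- Forward transform of a multiplier table (radix `deg i + 1` input). [this work] -/
def fwdA (m : ℕ) (deg : ℕ → ℕ) (g : ℕ → ℤ) : Array ℤ :=
  fwd (radA deg) (radF deg) (MA deg) m m (mkArr (plc (radA deg) m) g)

/-- Pointwise accumulation `−FH·FB + Σ_{j<K} FT_j·FA_j` of the transformed tables, one target at a time
(so that only a bounded number of arrays is alive). [this work] -/
def accum (m : ℕ) (deg : ℕ → ℕ) (t : ℕ → ℕ → ℤ) (h : ℕ → ℤ) (a : ℕ → ℕ → ℕ) (b : ℕ → ℕ) : ℕ → Array ℤ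
  | 0 =>
    let FH := fwdT m deg h
    let FB := fwdA m deg (fun k => (b k : ℤ))
    mkArr (plc (radF deg) m) fun p => -(rd FH p * rd FB p)
  | j + 1 =>
    let P := accum m deg t h a b j
    let FT := fwdT m deg (t j)
    let FA := fwdA m deg (fun k => (a j k : ℤ))
    mkArr (plc (radF deg) m) fun p => rd P p + rd FT p * rd FA p

/-- The scaled fibre-coefficient array of the certificate `(a, b)` for `(t, h)`. [this work] -/
def evalArr (m : ℕ) (deg : ℕ → ℕ) (K : ℕ) (t : ℕ → ℕ → ℤ) (h : ℕ → ℤ) (a : ℕ → ℕ → ℕ) (b : ℕ → ℕ) :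
    Array ℤ :=
  let P := accum m deg t h a b K
  fwd (radF deg) (radF deg) (NI deg) m m (mkArr (plc (radF deg) m) fun p => rd P p)

/-- THE CHECK: all scaled fibre coefficients are nonnegative. [this work] -/
def evalCheck (m : ℕ) (deg : ℕ → ℕ) (K : ℕ) (t : ℕ → ℕ → ℤ) (h : ℕ → ℤ) (a : ℕ → ℕ → ℕ) (b : ℕ → ℕ) :
    Bool :=
  let E := evalArr m deg K t h a b
  allB (fun p => decide (0 ≤ rd E p)) (plc (radF deg) m)

/-- A passed check gives nonnegative entries. [this work] -/
theorem rd_evalArr_nonneg {m : ℕ} {deg : ℕ → ℕ} {K : ℕ} {t : ℕ → ℕ → ℤ} {h : ℕ → ℤ} {a : ℕ → ℕ → ℕ}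
    {b : ℕ → ℕ} (hc : evalCheck m deg K t h a b = true) {p : ℕ} (hp : p < plc (radF deg) m) :
    0 ≤ rd (evalArr m deg K t h a b) p := by
  unfold evalCheck at hc
  have := (allB_iff _ _).1 hc p hp
  simpa using this

/-! ## Semantics of the checker -/

/-- The evaluation functional of a table `f` (input radix `rin`, matrix `M`) at the point `q`. [this work] -/
def EV (rin : ℕ → ℕ) (M : ℕ → ℕ → ℕ → ℤ) (m : ℕ) (deg : ℕ → ℕ) (f : ℕ → ℤ) (q : ℕ) : ℤ :=
  ∑ c ∈ range (plc rin m), f c * ∏ i ∈ range m, M i (dig (radF deg) i q) (dig rin i c)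

/-- Semantics of `fwdT`. [this work] -/
theorem rd_fwdT (m : ℕ) (deg : ℕ → ℕ) (f : ℕ → ℤ) {q : ℕ} (hq : q < plc (radF deg) m) :
    rd (fwdT m deg f) q = EV (fun _ => 2) (MT deg) m deg f q :=
  rd_fwd_full _ _ _ two_pos' two_le4 (radF_pos deg) m f hq

/-- Semantics of `fwdA`. [this work] -/
theorem rd_fwdA (m : ℕ) {deg : ℕ → ℕ} (hdeg : ∀ i, deg i = 1 ∨ deg i = 2) (g : ℕ → ℤ) {q : ℕ}
    (hq : q < plc (radF deg) m) : rd (fwdA m deg g) q = EV (radA deg) (MA deg) m deg g q :=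
  rd_fwd_full _ _ _ (radA_pos deg) (radA_le4 hdeg) (radF_pos deg) m g hq

/-- The (unscaled) fibre coefficient: `Σ_{c + k = p (digitwise)} G(c, k)`. [this work] -/
def fibD (m : ℕ) (deg : ℕ → ℕ) (G : ℕ → ℕ → ℤ) (p : ℕ) : ℤ :=
  ∑ c ∈ range (plc (fun _ => 2) m), ∑ k ∈ range (plc (radA deg) m),
    if (∀ i < m, dig (radF deg) i p = dig (fun _ => 2) i c + dig (radA deg) i k) then G c k else 0

/-- The total scale `Π_i scal`. [this work] -/
def SC (m : ℕ) (deg : ℕ → ℕ) : ℤ := ∏ i ∈ range m, scal (radF deg i)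

/-- The scale is positive. [this work] -/
theorem SC_pos (m : ℕ) (deg : ℕ → ℕ) : 0 < SC m deg :=
  prod_pos fun i _ => by unfold scal; split_ifs <;> norm_num

/-- Bilinear expansion of the pointwise combination. [this work] -/
theorem bilinear_expand {R : Type*} [CommRing R] (K : ℕ) (Sc Sk : Finset ℕ) (T : ℕ → ℕ → R) (Hh : ℕ → R)
    (A : ℕ → ℕ → R) (B : ℕ → R) (X : ℕ → R) (Y : ℕ → R) :
    (∑ j ∈ range K, (∑ c ∈ Sc, T j c * X c) * (∑ k ∈ Sk, A j k * Y k)) -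
        (∑ c ∈ Sc, Hh c * X c) * (∑ k ∈ Sk, B k * Y k) =
      ∑ c ∈ Sc, ∑ k ∈ Sk, ((∑ j ∈ range K, T j c * A j k) - Hh c * B k) * (X c * Y k) := by
  have h1 : ∀ j ∈ range K, (∑ c ∈ Sc, T j c * X c) * (∑ k ∈ Sk, A j k * Y k) =
      ∑ c ∈ Sc, ∑ k ∈ Sk, T j c * A j k * (X c * Y k) := by
    intro j _
    rw [sum_mul_sum]
    exact sum_congr rfl fun c _ => sum_congr rfl fun k _ => by ring
  have h2 : (∑ c ∈ Sc, Hh c * X c) * (∑ k ∈ Sk, B k * Y k) = ∑ c ∈ Sc, ∑ k ∈ Sk, Hh c * B k * (X c * Y k) := by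
    rw [sum_mul_sum]
    exact sum_congr rfl fun c _ => sum_congr rfl fun k _ => by ring
  rw [sum_congr rfl h1, h2, sum_comm, ← sum_sub_distrib]
  refine sum_congr rfl fun c _ => ?_
  rw [sum_comm, ← sum_sub_distrib]
  refine sum_congr rfl fun k _ => ?_
  rw [sub_mul, sum_mul]

/-- Semantics of the accumulation. [this work] -/
theorem rd_accum (m : ℕ) {deg : ℕ → ℕ} (hdeg : ∀ i, deg i = 1 ∨ deg i = 2) (t : ℕ → ℕ → ℤ) (h : ℕ → ℤ)
    (a : ℕ → ℕ → ℕ) (b : ℕ → ℕ) :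
    ∀ (K : ℕ) {q : ℕ}, q < plc (radF deg) m → rd (accum m deg t h a b K) q =
      (∑ j ∈ range K, EV (fun _ => 2) (MT deg) m deg (t j) q * EV (radA deg) (MA deg) m deg (fun k => (a j k : ℤ)) q) -
        EV (fun _ => 2) (MT deg) m deg h q * EV (radA deg) (MA deg) m deg (fun k => (b k : ℤ)) q
  | 0, q, hq => by
    simp only [accum]
    rw [rd_mkArr, if_pos hq, rd_fwdT _ _ _ hq, rd_fwdA _ hdeg _ hq]
    simp
  | K + 1, q, hq => by
    simp only [accum]
    rw [rd_mkArr, if_pos hq, rd_accum m hdeg t h a b K hq, rd_fwdT _ _ _ hq, rd_fwdA _ hdeg _ hq, sum_range_succ]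
    ring

/-- **Semantics of `evalArr`**: entry `p` is `SC · fibD(p)` for the pairing `G = Σ_j t_j ⊗ a_j − h ⊗ b`.
[this work] -/
theorem rd_evalArr {m : ℕ} {deg : ℕ → ℕ} (hdeg : ∀ i, deg i = 1 ∨ deg i = 2) (K : ℕ) (t : ℕ → ℕ → ℤ)
    (h : ℕ → ℤ) (a : ℕ → ℕ → ℕ) (b : ℕ → ℕ) {p : ℕ} (hp : p < plc (radF deg) m) :
    rd (evalArr m deg K t h a b) p = SC m deg * fibD m deg (pairing K t h a b) p := by
  unfold evalArr
  simp only []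
  rw [rd_fwd_full _ _ _ (radF_pos deg) (radF_le4 hdeg) (radF_pos deg) m _ hp]
  -- the point values, bilinearly expanded
  have hpt : ∀ q ∈ range (plc (radF deg) m), rd (accum m deg t h a b K) q *
      ∏ i ∈ range m, NI deg i (dig (radF deg) i p) (dig (radF deg) i q) =
      ∑ c ∈ range (plc (fun _ => 2) m), ∑ k ∈ range (plc (radA deg) m), pairing K t h a b c k *
        ∏ i ∈ range m, (NI deg i (dig (radF deg) i p) (dig (radF deg) i q) *
          (MT deg i (dig (radF deg) i q) (dig (fun _ => 2) i c) * MA deg i (dig (radF deg) i q) (dig (radA deg) i k))) := by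
    intro q hq
    rw [rd_accum m hdeg t h a b K (mem_range.1 hq)]
    have hbil := bilinear_expand (R := ℤ) K (range (plc (fun _ => 2) m)) (range (plc (radA deg) m)) t h
      (fun j k => (a j k : ℤ)) (fun k => (b k : ℤ))
      (fun c => ∏ i ∈ range m, MT deg i (dig (radF deg) i q) (dig (fun _ => 2) i c))
      (fun k => ∏ i ∈ range m, MA deg i (dig (radF deg) i q) (dig (radA deg) i k))
    simp only [EV] at hbil ⊢
    rw [hbil, sum_mul]
    refine sum_congr rfl fun c _ => ?_
    rw [sum_mul]
    refine sum_congr rfl fun k _ => ?_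
    unfold pairing
    rw [← prod_mul_distrib, mul_assoc, ← prod_mul_distrib]
    refine congrArg _ (prod_congr rfl fun i _ => ?_)
    ring
  rw [sum_congr rfl hpt]
  -- exchange the sums and evaluate the inner sum over q by digit Fubini and the key identity
  rw [sum_comm]
  unfold fibD
  rw [mul_sum]
  refine sum_congr rfl fun c _ => ?_
  rw [sum_comm, mul_sum]
  refine sum_congr rfl fun k _ => ?_
  rw [← mul_sum]
  rw [sum_prod_dig (radF_pos deg)
    (fun i e => NI deg i (dig (radF deg) i p) e * (MT deg i e (dig (fun _ => 2) i c) * MA deg i e (dig (radA deg) i k))) m]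
  have hkey : ∀ i ∈ range m, ∑ e ∈ range (radF deg i), NI deg i (dig (radF deg) i p) e *
      (MT deg i e (dig (fun _ => 2) i c) * MA deg i e (dig (radA deg) i k)) =
      if dig (radF deg) i p = dig (fun _ => 2) i c + dig (radA deg) i k then scal (radF deg i) else 0 := by
    intro i _
    unfold NI MT MA radF
    exact key_deg (hdeg i) (by have := dig_lt (radF_pos deg) i p; unfold radF at this; exact this)
      (dig_lt two_pos' i c) (by have := dig_lt (radA_pos deg) i k; unfold radA at this; exact this)
  rw [prod_congr rfl hkey, prod_ite_zero]
  unfold SC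
  by_cases H : ∀ i < m, dig (radF deg) i p = dig (fun _ => 2) i c + dig (radA deg) i k
  · have H' : ∀ i ∈ range m, dig (radF deg) i p = dig (fun _ => 2) i c + dig (radA deg) i k :=
      fun i hi => H i (mem_range.1 hi)
    rw [if_pos H', if_pos H, mul_comm]
  · have H' : ¬ ∀ i ∈ range m, dig (radF deg) i p = dig (fun _ => 2) i c + dig (radA deg) i k :=
      fun H' => H fun i hi => H' i (mem_range.2 hi)
    rw [if_neg H', if_neg H, mul_zero, mul_zero]

/-- Nonnegativity of the fibre coefficients from a passed check. [this work] -/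
theorem fibD_nonneg_of_evalCheck {m : ℕ} {deg : ℕ → ℕ} (hdeg : ∀ i, deg i = 1 ∨ deg i = 2) {K : ℕ}
    {t : ℕ → ℕ → ℤ} {h : ℕ → ℤ} {a : ℕ → ℕ → ℕ} {b : ℕ → ℕ} (hc : evalCheck m deg K t h a b = true)
    {p : ℕ} (hp : p < plc (radF deg) m) : 0 ≤ fibD m deg (pairing K t h a b) p := by
  have h1 := rd_evalArr_nonneg hc hp
  rw [rd_evalArr hdeg K t h a b hp] at h1
  exact (mul_nonneg_iff_of_pos_left (SC_pos m deg)).1 h1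

end Summit.CriticalPhenomena.PercolationContinuityZ3.Theorems.TwoCopy
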